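import Literature.RingTheory.Idempotents.FiniteAlgebraLocalDecomposition
import Mathlib.RingTheory.Ideal.Quotient.Operations
import Mathlib.RingTheory.LocalRing.ResidueField.Basic
import HarnessLib

/-!
# The corner of an integral point is its reduction (finite algebras over a local ring, separating idempotents)
# ([StacksProject] Tag 04GG; the reduction half of the (S-γ2) «specialisation of geometric fibres» dictionary)

Topic `Literature/RingTheory/Idempotents`.  THEOREMS only (no def, no instance, no notation, no named fact, no `sorry`).  Cell `hodgecm-mathlib`
(D-0151), FLOOR 0, programme F0P5a, crux item stmt-HodgeConjecture-24832 — (S-γ2) assembly (desk `F0/P5a/S-gamma2-DESK.v0` §1/§2 (G3); F0P5a LEAD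
WORDS #11/#12).  For `(V, 𝔪)` LOCAL, `A` a module-finite commutative `V`-algebra and the SEPARATING family `e_I` of ★ p798139
`exists_completeOrthogonalIdempotents_isLocalRing_of_lift` (indexed by `I ∈ MaximalSpectrum (A ⧸ 𝔪A)`, `1 - e_I ∈ I.comap mk`, `e_I ∈ I'.comap mk`
for `I' ≠ I`): a `V`-valued point `ψ : A →ₐ[V] V` LANDS IN THE CORNER `I` (`ψ(e_I) ≡ 1 mod 𝔪`) IFF ITS REDUCTION — the maximal ideal
`ker (residue ∘ ψ)` of `A`, which contains `𝔪A` — IS `I.comap mk` (`apply_sub_one_mem_iff_ker_eq_comap`).  Together with the corner-by-corner point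
count (F0P5a-p04 (g2) `card_algHom_eq_sum` / `card_algHom_map_eq_one_eq`, F0P5a-p01 (g2) `card_algHom_eq_finrank_of_isReduced_baseChange`) this
is the algebraic form of «the number of generic geometric points specialising to a given point of the special fibre is the rank of the local
factor there».

HC_CM is proved only modulo the 7 printed citations until rung 0 closes; this file is a generic leaf and changes no count.

## References
* [StacksProject] The Stacks Project, Tag 04GG (Lemma 10.153.3–10.153.4: finite algebras over henselian local rings and their idempotents).
-/

set_option autoImplicit false

namespace Literature.RingTheory.Idempotents

open IsLocalRing

/-! ### §3 The corner of an integral point is its reduction (local base, separating family) -/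

section Reduction

variable {V A : Type*} [CommRing V] [IsLocalRing V] [CommRing A] [Algebra V A] [Module.Finite V A]

omit [Module.Finite V A] in
/-- The reduction `ker (residue ∘ ψ)` of a `V`-point `ψ : A →ₐ[V] V` is a maximal ideal of `A` containing `𝔪A`. [cite: StacksProject, Tag 04GG] -/
theorem isMaximal_ker_residue_comp (ψ : A →ₐ[V] V) :
    (RingHom.ker ((residue V).comp (ψ : A →+* V))).IsMaximal ∧
      (maximalIdeal V).map (algebraMap V A) ≤ RingHom.ker ((residue V).comp (ψ : A →+* V)) := by
  have hsurj : Function.Surjective ((residue V).comp (ψ : A →+* V)) := fun r => by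
    obtain ⟨s, rfl⟩ := residue_surjective r
    exact ⟨algebraMap V A s, by simp⟩
  refine ⟨RingHom.ker_isMaximal_of_surjective _ hsurj, ?_⟩
  rw [Ideal.map_le_iff_le_comap]
  intro m hm
  rw [Ideal.mem_comap, RingHom.mem_ker, RingHom.comp_apply]
  change residue V (ψ (algebraMap V A m)) = 0
  rw [AlgHom.commutes, residue_eq_zero_iff]
  exact hm

/-- **The corner of an integral point is its reduction.**  Let `e_I` (`I ∈ MaxSpec (A ⧸ 𝔪A)`) be a family of elements of `A` SEPARATING the
maximal ideals as in ★ `exists_completeOrthogonalIdempotents_isLocalRing_of_lift` (`1 - e_I ∈ I.comap mk`, `e_I ∈ I'.comap mk` for `I' ≠ I`), and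
`ψ : A →ₐ[V] V` a `V`-point with reduction `𝔫 := ker (residue ∘ ψ)`.  Then `ψ(e_I) ≡ 1 (mod 𝔪)` IFF `𝔫 = I.comap mk`.
[cite: StacksProject, Tag 04GG (10.153.3)] -/
theorem apply_sub_one_mem_iff_ker_eq_comap (e : MaximalSpectrum (A ⧸ (maximalIdeal V).map (algebraMap V A)) → A)
    (hsep1 : ∀ I, 1 - e I ∈ I.asIdeal.comap (Ideal.Quotient.mk _)) (hsep0 : ∀ I I', I ≠ I' → e I ∈ I'.asIdeal.comap (Ideal.Quotient.mk _))
    (ψ : A →ₐ[V] V) (I : MaximalSpectrum (A ⧸ (maximalIdeal V).map (algebraMap V A))) :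
    ψ (e I) - 1 ∈ maximalIdeal V ↔
      RingHom.ker ((residue V).comp (ψ : A →+* V)) = I.asIdeal.comap (Ideal.Quotient.mk ((maximalIdeal V).map (algebraMap V A))) := by
  obtain ⟨h𝔫, h𝔫le⟩ := isMaximal_ker_residue_comp ψ
  -- membership in `𝔫` is «`ψ(a) ∈ 𝔪`»
  have hmem : ∀ a : A, a ∈ RingHom.ker ((residue V).comp (ψ : A →+* V)) ↔ ψ a ∈ maximalIdeal V := fun a => by
    rw [RingHom.mem_ker, RingHom.comp_apply, residue_eq_zero_iff]; rfl
  -- the reduction `J` of `𝔫` in `MaxSpec (A ⧸ 𝔪A)`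
  let J : MaximalSpectrum (A ⧸ (maximalIdeal V).map (algebraMap V A)) :=
    ⟨(RingHom.ker ((residue V).comp (ψ : A →+* V))).map (Ideal.Quotient.mk _), isMaximal_map_mk (R := V) _ h𝔫⟩
  have hJ : J.asIdeal.comap (Ideal.Quotient.mk ((maximalIdeal V).map (algebraMap V A))) = RingHom.ker ((residue V).comp (ψ : A →+* V)) :=
    comap_map_mk (R := V) _ h𝔫
  constructor
  · intro h
    -- if `J ≠ I` then `e I ∈ 𝔫` and `1 - e I ∈ 𝔫`… no: `ψ (e I) ∈ 1 + 𝔪` is not in `𝔪`; so `J = I`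
    by_contra hne
    have hJI : J ≠ I := fun hJI => hne (by rw [← hJ, hJI])
    have h1 : e I ∈ RingHom.ker ((residue V).comp (ψ : A →+* V)) := by rw [← hJ]; exact hsep0 I J (Ne.symm hJI)
    rw [hmem] at h1
    have : (1 : V) ∈ maximalIdeal V := by simpa using (maximalIdeal V).sub_mem h1 h
    exact (maximalIdeal V).ne_top_iff_one.mp (maximalIdeal.isMaximal V).ne_top this
  · intro h
    have h1 : 1 - e I ∈ RingHom.ker ((residue V).comp (ψ : A →+* V)) := by rw [h]; exact hsep1 I
    rw [hmem, map_sub, map_one] at h1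
    rw [← Ideal.neg_mem_iff, neg_sub]; exact h1

end Reduction

end Literature.RingTheory.Idempotents
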